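import Mathlib
import Summits.ValiantsHypothesis.ValiantsHypothesis.Theorems.KPlusLogSqLawWeakLiftingTowerGraftSkewBlockIdentityCrossings
import Literature.LinearAlgebra.Matrix.CharpolySignAlternation

/-!
# Tower graft line — THE SKEW-BLOCK IDENTITY GRAFT HAS NO DIGIT EVENT AT ALL (S4's object; every size, every datum)

Calibration file for the line `Cruxes/WeakLifting/Lines/tower_graft.lean` (crux `WeakLifting` = stmt-ValiantsHypothesis-19561), for the object
of S4 `stub_graftLawId`.  NO stub is claimed.  In the digit expansion of the line (`TowerDigitExpansion`, S1),
`det(G + X^D·1) = Σⱼ X^{jD}·Eⱼ` with `Eⱼ = ` the `T^j`-coefficient of `Q(T) = det(G + T·1)` (S1's `Q` at `Stop = 1`, since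
`(1 : Matrix).map` of a ring hom is `1`, `Matrix.map_one`).  For the symmetric SKEW-BLOCK pencils
`G_η = [[ηX^{d_{l₀}}·1, B(X)], [B(X)ᵀ, −ηX^{d_{l₀}}·1]]` (square blocks) of p688917 / p689545 / p699141 / p701122 / p702623:

* (cited, not restated) the tree's `Literature.LinearAlgebra.Matrix.CharpolySignAlternation.posDef_iff_sign_mul_charpoly_coeff_pos`
  (Blekherman–Parrilo–Thomas Prop. A.2 (5)): for `P ≻ 0` of size `n`, `(−1)^{n−k}·(χ_P)ₖ > 0` for every `k < n`; `(χ_P)ₙ = 1`.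
* `skewBlock_identityGraft_fibre` — at a real point, `det(G_η(t) + T·1) = det(T²·1 − (a²·1 + B(t)ᵀB(t)))`, `a = ηt^{d_{l₀}}`, whenever
  `T + a ≠ 0` (Schur for scalar blocks, p699141 `det_fromBlocks_smul_one`). [folklore]
* `skewBlock_identityGraft_digits_rootless` — **for every `η ≠ 0`, every support, every block data `B` and every `j`, the digit `Eⱼ` of the
  identity graft on `G_η` has NO positive root**: at `t > 0` the fibre polynomial is `χ_{P(t)}(T²)` with `P(t) = a²·1 + B(t)ᵀB(t) ≻ 0`
  (`Polynomial.expand`), so `E_{2k}(t) = (χ_{P(t)})ₖ ≠ 0` for `k ≤ q+1` and every other digit vanishes identically.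

READING (NO-GO ledger, kill-shape #38⁺, S4 row): together with the crossings of p699141 (m = 6: 18), p701122 (every m ∈ 6ℕ⁺: 3m), p702623 (every
p689545 datum: 2N) the row «`Z₊(det(G + X^D·1)) ≤ c·#{eigenvalue events or DIGIT events of the expansion} + g(m)`» is KERNEL-dead for those `g`:
on the skew-block families the identity graft has neither kind of event.  Inside the class budget; ZERO crux credit.
HONEST FRAMING: linear algebra; nothing on S4/S4b/S5/S5ᴸ, TowerB, `WeakLifting`, Conjecture B, `MatrixDescartes` (18050) or `VP ≠ VNP`.  Def-free.
Seat: prover val-sym-lift-p2 g20, `--supports stmt-ValiantsHypothesis-19561`.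
-/

-- `Summit.ValiantsHypothesis.ValiantsHypothesis.…` repeats a component by the D-0017 layout
-- (single-conjunct summit), which the `dupNamespace` linter flags; the name is mandated.
set_option linter.dupNamespace false

namespace Summit.ValiantsHypothesis.ValiantsHypothesis.Theorems.KPlusLogSqLaw.TowerGraft

open Polynomial Matrix
open scoped BigOperators Polynomial

section IdentityGraftDigits

/-- **the fibre of the identity graft at a real point** (Schur for scalar blocks): for the evaluated skew-block pencil,
`det(G_η(t) + T·1) = det(T²·1 − (a²·1 + B(t)ᵀB(t)))` with `a = η t^{d_{l₀}}`, whenever `T + a ≠ 0`. [folklore] -/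
theorem skewBlock_identityGraft_fibre {q K : ℕ} (d : Fin K → ℕ) (l₀ : Fin K) (B : Fin K → Matrix (Fin (q + 1)) (Fin (q + 1)) ℝ)
    (η t T : ℝ) (hT : T + η * t ^ d l₀ ≠ 0) :
    ((∑ l, t ^ d l • Matrix.fromBlocks (if l = l₀ then η • (1 : Matrix (Fin (q + 1)) (Fin (q + 1)) ℝ) else 0) (B l) (B l)ᵀ
        (if l = l₀ then -(η • (1 : Matrix (Fin (q + 1)) (Fin (q + 1)) ℝ)) else 0)) +
      T • (1 : Matrix (Fin (q + 1) ⊕ Fin (q + 1)) (Fin (q + 1) ⊕ Fin (q + 1)) ℝ)).det =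
    ((T ^ 2) • (1 : Matrix (Fin (q + 1)) (Fin (q + 1)) ℝ) -
      ((η * t ^ d l₀) ^ 2 • (1 : Matrix (Fin (q + 1)) (Fin (q + 1)) ℝ) + (∑ l, t ^ d l • B l)ᵀ * (∑ l, t ^ d l • B l))).det := by
  rw [skewBlock_pencil_eval]
  have h1 : T • (1 : Matrix (Fin (q + 1) ⊕ Fin (q + 1)) (Fin (q + 1) ⊕ Fin (q + 1)) ℝ) =
      Matrix.fromBlocks (T • (1 : Matrix (Fin (q + 1)) (Fin (q + 1)) ℝ)) 0 0 (T • 1) := by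
    rw [← Matrix.fromBlocks_one, Matrix.fromBlocks_smul, smul_zero]
  rw [h1, Matrix.fromBlocks_add, add_zero, add_zero, ← add_smul, neg_add_eq_sub, ← sub_smul]
  rw [det_fromBlocks_smul_one _ _ (by rwa [add_comm]) _ _]
  congr 1
  rw [show (η * t ^ d l₀ + T) * (T - η * t ^ d l₀) = T ^ 2 - (η * t ^ d l₀) ^ 2 by ring, sub_smul]
  abel

/-- **NO DIGIT EVENT**: for every `η ≠ 0`, support `d`, square block data `B` and index `j`, the `T^j`-coefficient `Eⱼ ∈ ℝ[X]` of
`Q(T) = det(G_η + T·1)` (the `j`-th digit of the identity graft `det(G_η + X^D·1) = Σⱼ X^{jD}Eⱼ`, `D` large) has no positive root.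
[this work] -/
theorem skewBlock_identityGraft_digits_rootless {q K : ℕ} (d : Fin K → ℕ) (l₀ : Fin K)
    (B : Fin K → Matrix (Fin (q + 1)) (Fin (q + 1)) ℝ) {η : ℝ} (hη : η ≠ 0) (j : ℕ) :
    ((((∑ l, (X : ℝ[X]) ^ d l • (Matrix.fromBlocks (if l = l₀ then η • (1 : Matrix (Fin (q + 1)) (Fin (q + 1)) ℝ) else 0) (B l)
        (B l)ᵀ (if l = l₀ then -(η • (1 : Matrix (Fin (q + 1)) (Fin (q + 1)) ℝ)) else 0)).map C).map
        (C : ℝ[X] →+* Polynomial ℝ[X]) +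
      (X : Polynomial ℝ[X]) • (1 : Matrix (Fin (q + 1) ⊕ Fin (q + 1)) (Fin (q + 1) ⊕ Fin (q + 1)) (Polynomial ℝ[X]))).det.coeff
        j).roots.toFinset.filter (fun t => 0 < t)).card = 0 := by
  classical
  set F : Fin K → Matrix (Fin (q + 1) ⊕ Fin (q + 1)) (Fin (q + 1) ⊕ Fin (q + 1)) ℝ := fun l =>
    Matrix.fromBlocks (if l = l₀ then η • (1 : Matrix (Fin (q + 1)) (Fin (q + 1)) ℝ) else 0) (B l) (B l)ᵀ
      (if l = l₀ then -(η • (1 : Matrix (Fin (q + 1)) (Fin (q + 1)) ℝ)) else 0) with hF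
  set G : Matrix (Fin (q + 1) ⊕ Fin (q + 1)) (Fin (q + 1) ⊕ Fin (q + 1)) ℝ[X] := ∑ l, (X : ℝ[X]) ^ d l • (F l).map C with hG
  set Q : Polynomial ℝ[X] := (G.map (C : ℝ[X] →+* Polynomial ℝ[X]) +
    (X : Polynomial ℝ[X]) • (1 : Matrix (Fin (q + 1) ⊕ Fin (q + 1)) (Fin (q + 1) ⊕ Fin (q + 1)) (Polynomial ℝ[X]))).det with hQ
  set P : ℝ → Matrix (Fin (q + 1)) (Fin (q + 1)) ℝ := fun t =>
    (η * t ^ d l₀) ^ 2 • (1 : Matrix (Fin (q + 1)) (Fin (q + 1)) ℝ) + (∑ l, t ^ d l • B l)ᵀ * (∑ l, t ^ d l • B l) with hP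
  -- two-variable evaluation of `Q`
  have hQeval : ∀ t T : ℝ, (Polynomial.eval₂RingHom (Polynomial.evalRingHom t) T) Q = ((∑ l, t ^ d l • F l) + T • 1).det := by
    intro t T
    rw [hQ, RingHom.map_det]
    congr 1
    ext i k
    simp only [hG, RingHom.mapMatrix_apply, Matrix.map_apply, Matrix.add_apply, Matrix.smul_apply, Matrix.sum_apply,
      Matrix.one_apply, smul_eq_mul, Polynomial.coe_eval₂RingHom, Polynomial.eval₂_add, Polynomial.eval₂_mul,
      Polynomial.eval₂_C, Polynomial.eval₂_X, Polynomial.coe_evalRingHom, Polynomial.eval_finsetSum, Polynomial.eval_mul,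
      Polynomial.eval_pow, Polynomial.eval_X, Polynomial.eval_C]
    congr 1
    by_cases hik : i = k
    · simp [hik]
    · simp [hik]
  -- the fibre at `t > 0` is `χ_{P(t)}(T²)`
  have hfib : ∀ t : ℝ, 0 < t → Q.map (Polynomial.evalRingHom t) = Polynomial.expand ℝ 2 ((P t).charpoly) := by
    intro t ht
    apply Polynomial.eq_of_infinite_eval_eq
    refine Set.Infinite.mono (fun T (hTa : -(η * t ^ d l₀) < T) => ?_) (Set.Ioi_infinite (-(η * t ^ d l₀)))
    show eval T (Q.map (Polynomial.evalRingHom t)) = eval T (Polynomial.expand ℝ 2 (P t).charpoly)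
    rw [Polynomial.eval_map, ← Polynomial.coe_eval₂RingHom, hQeval, Polynomial.expand_eval, hF,
      skewBlock_identityGraft_fibre d l₀ B η t T (by linarith), det_smul_one_sub_eq_eval_charpoly]
  -- the digits at `t > 0`
  have hdigit : ∀ t : ℝ, 0 < t → (Q.coeff j).eval t = if 2 ∣ j then (P t).charpoly.coeff (j / 2) else 0 := by
    intro t ht
    have h1 : (Q.coeff j).eval t = (Q.map (Polynomial.evalRingHom t)).coeff j := by
      rw [Polynomial.coeff_map, Polynomial.coe_evalRingHom]
    rw [h1, hfib t ht, Polynomial.coeff_expand (by norm_num : 0 < 2)]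
  have hPd : ∀ t : ℝ, 0 < t → (P t).PosDef := fun t ht =>
    posDef_sq_smul_one_add_transpose_mul_self _ (mul_ne_zero hη (pow_ne_zero _ ht.ne')) _
  by_cases hj : 2 ∣ j ∧ j / 2 ≤ q + 1
  · -- an even digit of index `≤ 2(q+1)`: sign-definite on `(0, ∞)`
    refine card_posRoots_eq_zero_of_eval_ne_zero _ fun t ht => ?_
    rw [hdigit t ht, if_pos hj.1]
    rcases hj.2.lt_or_eq with hlt | heq
    · -- strict sign alternation of `χ_P` for `P ≻ 0` (Blekherman–Parrilo–Thomas A.2 (5), the tree's Literature theorem)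
      have hs := (Literature.LinearAlgebra.Matrix.CharpolySignAlternation.posDef_iff_sign_mul_charpoly_coeff_pos (hPd t ht).1).mp
        (hPd t ht) (j / 2) (by rw [Fintype.card_fin]; exact hlt)
      intro h0
      rw [h0, mul_zero] at hs
      exact lt_irrefl _ hs
    · -- the leading coefficient
      have hnd : (P t).charpoly.natDegree = j / 2 := by rw [Matrix.charpoly_natDegree_eq_dim, Fintype.card_fin, heq]
      rw [← hnd, (Matrix.charpoly_monic (P t)).coeff_natDegree]
      exact one_ne_zero
  · -- every other digit vanishes identically
    have hzero : Q.coeff j = 0 := by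
      apply Polynomial.eq_zero_of_infinite_isRoot
      refine Set.Infinite.mono (fun t (ht : (0 : ℝ) < t) => ?_) (Set.Ioi_infinite (0 : ℝ))
      show (Q.coeff j).IsRoot t
      rw [Polynomial.IsRoot.def, hdigit t ht]
      split_ifs with h2
      · have hlt : q + 1 < j / 2 := by
          by_contra h
          exact hj ⟨h2, not_lt.mp h⟩
        exact Polynomial.coeff_eq_zero_of_natDegree_lt (by rw [Matrix.charpoly_natDegree_eq_dim, Fintype.card_fin]; exact hlt)
      · rfl
    rw [hzero, Polynomial.roots_zero]
    rfl

end IdentityGraftDigits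

end Summit.ValiantsHypothesis.ValiantsHypothesis.Theorems.KPlusLogSqLaw.TowerGraft
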